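import Summits.HubbardSuperconductivity.HubbardSuperconductivity.Theorems.AnisotropyChordRealStabilityDefs
import Mathlib.Analysis.SpecialFunctions.Log.Basic
import Mathlib.Analysis.Normed.Algebra.Exponential

/-!
# Route `AnisotropyChord`: ENERGY CONVEXITY along the magnetisation ladder (E-CONV) — the theory seat's
# cycle-6 compressibility theorem TYPED, with the gate-symbol spectrum (S1) and the analytic glue PROVED
# (definitions; PORT-SPEC §71 S1 / P-7 typed layer; bears on `FerroSideChord` stmt-19089 and on the H0
# target's compressibility hypothesis)

Typing authority: THEORY seat `hubbard-h0-rotor-theory-1`, cycle 6, memo ROTOR-THEORY-6 §63, §67, §71–§74;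
`Sketch6.lean` §RealStability (S1 part) and §EnergyConvexity, transplanted verbatim up to docstring tags.

* S1 (PROVED): `gateSymbolMatrix A B C` — the symbol of the two-site imaginary-time gate as a zero-diagonal
  symmetric `4 × 4` matrix; its four explicit eigenvectors `gateSymbol_eig₁…₄` (eigenvalues `A+B+C`, `A−B−C`,
  `−A−B+C`, `−A+B−C`), their orthogonality, and `gateSymbol_atMostOnePositive_iff`: at most one positive
  eigenvalue iff `B − C ≤ A ≤ B + C` (= `|Δ| ≤ 1` by `gate_signature` of `…RealStabilityDefs`) — Step 1 of
  A-STAB modulo the Borcea–Brändén / COSW facts.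
* **E-CONV** `XXZSectorEnergyConvex` (THEOREM on paper, OPEN in Lean): for `Δ ∈ [−1,1]` on every finite graph
  the lowest sector energies are convex along the ladder, `2E(M) ≤ E(M−1) + E(M+1)`; finite-`t` form
  `XXZSectorHeatAmplitudeLogConcave`; spin-`S` + single-ion version `XXZSpinDSectorEnergyConvex` over
  `xxzDHamiltonian` (`xxzDHamiltonian_zero`: `D = h = 0` is the tree's XXZ Hamiltonian).
* PROVED analytic glue: `midpoint_convex_of_logConcave_rates` (log-concave positive amplitudes with
  exponential rates ⇒ midpoint convexity of the rates) and `rate_of_exp_sandwich`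
  (`a e^{−tE} ≤ c(t) ≤ b e^{−tE}` ⇒ `−t⁻¹ log c(t) → E`); the remaining spectral input (lemma R of
  PORT-SPEC §71: `−t⁻¹ log Re⟨v, e^{−tH} v⟩ →` the lowest eigenvalue of `H` seen by `v`; standard
  finite-dimensional spectral theory) is not typed here — it is a Mathlib-level lemma to be PROVED, not cited.

UNCONDITIONAL SLIVER in the tree: the first rung `W = 1` of E-CONV on connected vertex- and edge-transitive
graphs for all `Δ < 1` is `TwoMagnon.energyConvex_oneMagnon_of_edgeTransitive` (file
`…SpinMonotoneEnergyConvexOneMagnon`, rank-one branch).  Nothing here claims E-CONV in Lean.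
-/

set_option linter.dupNamespace false

noncomputable section

namespace Summit.HubbardSuperconductivity.HubbardSuperconductivity.Theorems.AnisotropyChord

open Matrix Complex Finset Filter Topology
open Literature.MathematicalPhysics.QuantumLattice Literature.Probability.LatticeModels

/-! ### S1: the gate symbol matrix and its spectrum -/

/-- The (zero-diagonal, symmetric) matrix of the gate symbol
`A(z_x z_y + w_x w_y) + B(z_x w_y + z_y w_x) + C(z_x w_x + z_y w_y)` in the variable order `(z_x, z_y, w_x, w_y)` (theory seat, memo §63/§71 S1). [folklore] -/
def gateSymbolMatrix (A B C : ℝ) : Matrix (Fin 4) (Fin 4) ℝ :=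
  !![0, A, C, B; A, 0, B, C; C, B, 0, A; B, C, A, 0]

/-- Eigenvector ₁ of the gate symbol matrix (theory seat S1). [folklore] -/
theorem gateSymbol_eig₁ (A B C : ℝ) :
    gateSymbolMatrix A B C *ᵥ ![1, 1, 1, 1] = (A + B + C) • ![1, 1, 1, 1] := by
  ext i; fin_cases i <;> simp [gateSymbolMatrix, mulVec, dotProduct, Fin.sum_univ_four] <;> ring

/-- Eigenvector ₂ of the gate symbol matrix (theory seat S1). [folklore] -/
theorem gateSymbol_eig₂ (A B C : ℝ) :
    gateSymbolMatrix A B C *ᵥ ![1, 1, -1, -1] = (A - B - C) • ![1, 1, -1, -1] := by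
  ext i; fin_cases i <;> simp [gateSymbolMatrix, mulVec, dotProduct, Fin.sum_univ_four] <;> ring

/-- Eigenvector ₃ of the gate symbol matrix (theory seat S1). [folklore] -/
theorem gateSymbol_eig₃ (A B C : ℝ) :
    gateSymbolMatrix A B C *ᵥ ![1, -1, 1, -1] = (-A - B + C) • ![1, -1, 1, -1] := by
  ext i; fin_cases i <;> simp [gateSymbolMatrix, mulVec, dotProduct, Fin.sum_univ_four] <;> ring

/-- Eigenvector ₄ of the gate symbol matrix (theory seat S1). [folklore] -/
theorem gateSymbol_eig₄ (A B C : ℝ) :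
    gateSymbolMatrix A B C *ᵥ ![1, -1, -1, 1] = (-A + B - C) • ![1, -1, -1, 1] := by
  ext i; fin_cases i <;> simp [gateSymbolMatrix, mulVec, dotProduct, Fin.sum_univ_four] <;> ring

/-- The four eigenvectors are pairwise orthogonal (so, being non-zero in dimension 4, they exhaust the
spectrum: the eigenvalues of the symbol are exactly `A+B+C, A-B-C, -A-B+C, -A+B-C`). Theory seat S1. [folklore] -/
theorem gateSymbol_eigvecs_orthogonal :
    (![1, 1, 1, 1] : Fin 4 → ℝ) ⬝ᵥ ![1, 1, -1, -1] = 0 ∧ (![1, 1, 1, 1] : Fin 4 → ℝ) ⬝ᵥ ![1, -1, 1, -1] = 0 ∧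
    (![1, 1, 1, 1] : Fin 4 → ℝ) ⬝ᵥ ![1, -1, -1, 1] = 0 ∧ (![1, 1, -1, -1] : Fin 4 → ℝ) ⬝ᵥ ![1, -1, 1, -1] = 0 ∧
    (![1, 1, -1, -1] : Fin 4 → ℝ) ⬝ᵥ ![1, -1, -1, 1] = 0 ∧ (![1, -1, 1, -1] : Fin 4 → ℝ) ⬝ᵥ ![1, -1, -1, 1] = 0 := by
  simp [dotProduct, Fin.sum_univ_four]

/-- **Lorentzian signature of the gate symbol ⟺ |Δ| ≤ 1.**  With `A, B + C > 0` the eigenvalue `A+B+C` is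
positive; the symbol has AT MOST ONE positive eigenvalue iff the other three are `≤ 0`, i.e. iff
`B - C ≤ A ≤ B + C` (given `C ≤ B`) — which by `gate_signature` (`…RealStabilityDefs`) is `-1 ≤ Δ ≤ 1`. Theory seat S1. [folklore] -/
theorem gateSymbol_atMostOnePositive_iff {A B C : ℝ} (hCB : C ≤ B) :
    (A - B - C ≤ 0 ∧ -A - B + C ≤ 0 ∧ -A + B - C ≤ 0) ↔ (B - C ≤ A ∧ A ≤ B + C) := by
  constructor
  · rintro ⟨h1, -, h3⟩; constructor <;> linarith
  · rintro ⟨h1, h2⟩; refine ⟨by linarith, by linarith, by linarith⟩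


/-! ### E-CONV typed, and the analytic glue -/

/-- **THEOREM E-CONV (memo §67; paper-level proof complete, corollary of T-INT / A-STAB).**  For the
spin-½ XXZ Hamiltonian `H(Δ) = xxzHamiltonian 1 G (−1) Δ = −Σ_{xy∈E}(SˣSˣ + SʸSʸ) − Δ Σ SᶻSᶻ` on ANY
finite graph and any anisotropy `Δ ∈ [−1, 1]`, the lowest sector energies `M ↦ E(M)` are CONVEX along the
magnetisation ladder: `2·E(M) ≤ E(M−1) + E(M+1)` whenever the three sectors are non-trivial.  (No pair
binding / no magnetisation jump / non-negative inverse compressibility at `T = 0`; sharp: fails at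
`Δ = 1.1` on every tested graph and at `Δ = −1.2` on `tree7`, `star+clique`.)  Proof: the generating
polynomial `Σ_W y^{n−W} (e^{−tH_W} e_W)(𝟙)` is real-rooted in `y` for every `t ≥ 0` (the imaginary-time
gates preserve real stability, T-INT), so its positive coefficients `c_W(t) = ⟨𝟙_W, e^{−tH_W} 𝟙_W⟩` are
log-concave in `W` (Newton); `−t⁻¹ log c_W(t) → E_W` gives convexity.  OPEN in Lean.
[conjecture: theory seat hubbard-h0-rotor-theory-1, cycle 6, 2026-08-27 — proved on paper (memo §67), Lean proof pending the Borcea–Brändén facts (PORT-SPEC §71 S5)] -/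
def XXZSectorEnergyConvex : Prop :=
  ∀ (V : Type) [Fintype V] [DecidableEq V] (G : SimpleGraph V) [DecidableRel G.Adj] (Δ : ℝ),
    -1 ≤ Δ → Δ ≤ 1 → ∀ M : ℝ,
      spinZSector (Λ := V) 1 (M - 1) ≠ ⊥ → spinZSector (Λ := V) 1 M ≠ ⊥ →
      spinZSector (Λ := V) 1 (M + 1) ≠ ⊥ →
        2 * lowestEnergyInSector 1 (xxzHamiltonian 1 G (-1) Δ) M ≤
          lowestEnergyInSector 1 (xxzHamiltonian 1 G (-1) Δ) (M - 1) +
            lowestEnergyInSector 1 (xxzHamiltonian 1 G (-1) Δ) (M + 1)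

/-- The finite-imaginary-time form behind E-CONV (memo §67): for every `t ≥ 0` the «condensate-projected
heat kernel amplitudes» `c_M(t) = ⟨𝟙_M, e^{−tH} 𝟙_M⟩` (`𝟙_M` = indicator of the sector-`M` basis
configurations) are LOG-CONCAVE along the ladder.  Stated with Mathlib's matrix exponential
`NormedSpace.exp (−t • H)` and the basis-configuration indicator.
[conjecture: theory seat hubbard-h0-rotor-theory-1, cycle 6, 2026-08-27 — proved on paper (memo §67)] -/
def XXZSectorHeatAmplitudeLogConcave : Prop :=
  ∀ (V : Type) [Fintype V] [DecidableEq V] (G : SimpleGraph V) [DecidableRel G.Adj] (Δ : ℝ),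
    -1 ≤ Δ → Δ ≤ 1 → ∀ (t : ℝ), 0 ≤ t → ∀ W : ℕ, 1 ≤ W → W + 1 ≤ Fintype.card V →
      let ind : ℕ → (TensorIndex V 2 → ℂ) := fun k σ =>
        if (Finset.univ.filter (fun x => σ x = 1)).card = k then 1 else 0
      let K : Matrix (TensorIndex V 2) (TensorIndex V 2) ℂ :=
        NormedSpace.exp (-(t : ℂ) • xxzHamiltonian 1 G (-1) Δ)
      let c : ℕ → ℝ := fun k => (star (ind k) ⬝ᵥ K *ᵥ ind k).re
      c (W - 1) * c (W + 1) ≤ c W * c W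

/-- **The analytic glue of E-CONV (PORT-SPEC P-7), proved:** log-concavity of three positive functions at every
`t > 0` together with exponential rates `-(log cᵢ t)/t → Eᵢ` gives midpoint convexity `2 E₁ ≤ E₀ + E₂`.  With
`cᵢ(t) = ⟨𝟙_{W∓1,W}, e^{-tH} 𝟙⟩` this is the last step of the proof of `XXZSectorEnergyConvex`. Theory seat (proved).
[folklore] -/
theorem midpoint_convex_of_logConcave_rates {c₀ c₁ c₂ : ℝ → ℝ} {E₀ E₁ E₂ : ℝ}
    (hpos : ∀ t : ℝ, 0 < t → 0 < c₀ t ∧ 0 < c₁ t ∧ 0 < c₂ t)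
    (hlc : ∀ t : ℝ, 0 < t → c₀ t * c₂ t ≤ c₁ t ^ 2)
    (h₀ : Tendsto (fun t => -Real.log (c₀ t) / t) atTop (𝓝 E₀))
    (h₁ : Tendsto (fun t => -Real.log (c₁ t) / t) atTop (𝓝 E₁))
    (h₂ : Tendsto (fun t => -Real.log (c₂ t) / t) atTop (𝓝 E₂)) :
    2 * E₁ ≤ E₀ + E₂ := by
  have hL : Tendsto (fun t => 2 * (-Real.log (c₁ t) / t)) atTop (𝓝 (2 * E₁)) := h₁.const_mul 2
  have hR : Tendsto (fun t => -Real.log (c₀ t) / t + -Real.log (c₂ t) / t) atTop (𝓝 (E₀ + E₂)) :=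
    h₀.add h₂
  refine le_of_tendsto_of_tendsto hL hR ?_
  filter_upwards [eventually_gt_atTop (0 : ℝ)] with t ht
  obtain ⟨hc0, hc1, hc2⟩ := hpos t ht
  have hlog : Real.log (c₀ t) + Real.log (c₂ t) ≤ 2 * Real.log (c₁ t) := by
    have h := Real.log_le_log (mul_pos hc0 hc2) (hlc t ht)
    rw [Real.log_mul hc0.ne' hc2.ne', Real.log_pow] at h
    simpa using h
  have ht' : 0 < t := ht
  rw [show 2 * (-Real.log (c₁ t) / t) = (-(2 * Real.log (c₁ t))) / t by ring,
      show -Real.log (c₀ t) / t + -Real.log (c₂ t) / t = (-(Real.log (c₀ t) + Real.log (c₂ t))) / t by ring]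
  exact div_le_div_of_nonneg_right (by linarith) ht'.le

/-- The spin-`n/2` XXZ Hamiltonian with single-ion anisotropies and fields (memo §73):
`H = −Σ_{xy∈E}(SˣSˣ + SʸSʸ + Δ SᶻSᶻ) + Σ_v D_v (Sᶻ_v)² + Σ_v h_v Sᶻ_v` (theory seat memo §73; the tree's
`xxzHamiltonian n G (−1) Δ` plus single-ion and field terms built from `siteSpin n v 2`). [folklore] -/
def xxzDHamiltonian (n : ℕ) {V : Type} [Fintype V] [DecidableEq V]
    (G : SimpleGraph V) [DecidableRel G.Adj] (Δ : ℝ) (D h : V → ℝ) : Op V (n + 1) :=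
  xxzHamiltonian n G (-1) Δ + ∑ v, ((D v : ℂ) • (siteSpin n v 2 * siteSpin n v 2) + (h v : ℂ) • siteSpin n v 2)

/-- **THEOREM E-CONV(S,D) (memo §72–§73; paper-level proof complete).**  For every spin `S = n/2`, every finite
graph, every anisotropy `Δ ∈ [−1, 1]`, all EASY-PLANE single-ion anisotropies `D_v ≥ 0` and all fields `h_v`,
the lowest sector energies of `xxzDHamiltonian n G Δ D h` are CONVEX along the magnetisation ladder:
`2·E(M) ≤ E(M−1) + E(M+1)` whenever the three sectors are non-trivial.  Proof: copy blow-up to spin ½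
(Borcea–Brändén: symmetric multi-affine stability ↔ Grace–Walsh–Szegő), the spin-½ gate preservers (A-STAB),
and the Gaussian multiplier sequence `m ↦ e^{−εD m²}` (Laguerre) for the single-ion gate; then Newton
log-concavity and the heat-kernel rate limit as in E-CONV.  Sharp in the sign of `D` (easy-axis `D < 0`:
jumps) and in `|Δ| ≤ 1`.  The `S → ∞` limits give convexity of `E₀(N)` for quantum rotors (`U_v ≥ 0`) and for
the repulsive Bose–Hubbard model on any graph (memo §73–§74).  OPEN in Lean.
[conjecture: theory seat hubbard-h0-rotor-theory-1, cycle 6, 2026-08-27 — proved on paper (memo §72–§73)] -/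
def XXZSpinDSectorEnergyConvex : Prop :=
  ∀ (n : ℕ) (V : Type) [Fintype V] [DecidableEq V] (G : SimpleGraph V) [DecidableRel G.Adj] (Δ : ℝ)
    (D h : V → ℝ), -1 ≤ Δ → Δ ≤ 1 → (∀ v, 0 ≤ D v) → ∀ M : ℝ,
      spinZSector (Λ := V) n (M - 1) ≠ ⊥ → spinZSector (Λ := V) n M ≠ ⊥ →
      spinZSector (Λ := V) n (M + 1) ≠ ⊥ →
        2 * lowestEnergyInSector n (xxzDHamiltonian n G Δ D h) M ≤
          lowestEnergyInSector n (xxzDHamiltonian n G Δ D h) (M - 1) +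
            lowestEnergyInSector n (xxzDHamiltonian n G Δ D h) (M + 1)

/-- Sanity link: with `D = h = 0`, `xxzDHamiltonian` is the tree's `xxzHamiltonian n G (−1) Δ`. [folklore] -/
theorem xxzDHamiltonian_zero (n : ℕ) {V : Type} [Fintype V] [DecidableEq V]
    (G : SimpleGraph V) [DecidableRel G.Adj] (Δ : ℝ) :
    xxzDHamiltonian n G Δ (fun _ => 0) (fun _ => 0) = xxzHamiltonian n G (-1) Δ := by
  simp [xxzDHamiltonian]

/-- The two-sided sandwich behind the rate lemma R, isolated as its own (purely real-analytic) lemma: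
if `a e^{−tE} ≤ c(t) ≤ b e^{−tE}` for `t ≥ t₀` with `0 < a ≤ b`, then `−t⁻¹ log c(t) → E`.  Theory seat
(proved). [folklore] -/
theorem rate_of_exp_sandwich {c : ℝ → ℝ} {E a b t₀ : ℝ} (ha : 0 < a)
    (hlo : ∀ t, t₀ ≤ t → a * Real.exp (-t * E) ≤ c t)
    (hhi : ∀ t, t₀ ≤ t → c t ≤ b * Real.exp (-t * E)) :
    Tendsto (fun t : ℝ => -Real.log (c t) / t) atTop (𝓝 E) := by
  have hb : 0 < b := by
    have h1 := hlo t₀ le_rfl; have h2 := hhi t₀ le_rfl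
    have : a * Real.exp (-t₀ * E) ≤ b * Real.exp (-t₀ * E) := h1.trans h2
    have hpos : 0 < Real.exp (-t₀ * E) := Real.exp_pos _
    nlinarith [mul_pos ha hpos]
  -- −log c(t)/t is squeezed between E − log b / t and E − log a / t, both → E.
  have key : ∀ t, t₀ ≤ t → 0 < t →
      E - Real.log b / t ≤ -Real.log (c t) / t ∧ -Real.log (c t) / t ≤ E - Real.log a / t := by
    intro t ht htp
    have hct : 0 < c t := lt_of_lt_of_le (mul_pos ha (Real.exp_pos _)) (hlo t ht)
    have l1 : Real.log a + (-t * E) ≤ Real.log (c t) := by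
      have := Real.log_le_log (mul_pos ha (Real.exp_pos _)) (hlo t ht)
      rwa [Real.log_mul ha.ne' (Real.exp_pos _).ne', Real.log_exp] at this
    have l2 : Real.log (c t) ≤ Real.log b + (-t * E) := by
      have := Real.log_le_log hct (hhi t ht)
      rwa [Real.log_mul hb.ne' (Real.exp_pos _).ne', Real.log_exp] at this
    have htne : t ≠ 0 := htp.ne'
    constructor
    · have h : E - Real.log b / t = (t * E - Real.log b) / t := by field_simp
      rw [h]; exact div_le_div_of_nonneg_right (by linarith) htp.le
    · have h : E - Real.log a / t = (t * E - Real.log a) / t := by field_simp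
      rw [h]; exact div_le_div_of_nonneg_right (by linarith) htp.le
  have hlim1 : Tendsto (fun t : ℝ => E - Real.log b / t) atTop (𝓝 E) := by
    have : Tendsto (fun t : ℝ => Real.log b / t) atTop (𝓝 0) :=
      tendsto_const_nhds.div_atTop tendsto_id
    simpa using tendsto_const_nhds.sub this
  have hlim2 : Tendsto (fun t : ℝ => E - Real.log a / t) atTop (𝓝 E) := by
    have : Tendsto (fun t : ℝ => Real.log a / t) atTop (𝓝 0) :=
      tendsto_const_nhds.div_atTop tendsto_id
    simpa using tendsto_const_nhds.sub this
  refine tendsto_of_tendsto_of_tendsto_of_le_of_le' hlim1 hlim2 ?_ ?_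
  · filter_upwards [eventually_ge_atTop t₀, eventually_gt_atTop 0] with t ht htp using (key t ht htp).1
  · filter_upwards [eventually_ge_atTop t₀, eventually_gt_atTop 0] with t ht htp using (key t ht htp).2


end Summit.HubbardSuperconductivity.HubbardSuperconductivity.Theorems.AnisotropyChord
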